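import Summits.HodgeConjecture.CorCM.Zeta7WeilFamiliesResidueCounts
import HarnessLib

/-!
# COR-CM: Deligne's Weil families over `ℚ(ζ₇)` with ALL eight CM types — the complete exceptionality criterion:
# the Weil classes of `⊕_j A_j` are divisor classes iff the two `ℚ(√-7)`-induced types occur equally often

Cell `pub-hodgecm2` (COR-CM = stage 2 of the Hodge ladder), seat b27 (gen 23), count-neutral; part 3b of the `ℚ(ζ₇)`
lane, the geometric reading of part 3a `CorCM/Zeta7WeilFamiliesResidueCounts` (`typeCount_symmetric_iff`: a
constant-sum family `Ψ : Fin (2m) → CMType ℚ(ζ₇)` is a union of conjugate pairs iff `resCount Ψ {1,2,4} =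
resCount Ψ {3,5,6}`).  NEW as stated (not a published statement), hence under `Summits/`; everything PROVED, theorems
only (no definition, no named fact, no `sorry`).

THE SOURCE CONSTRUCTION.  P. Deligne, *Hodge cycles on abelian varieties*, LNM 900 (1982), **I §5 (c)** (re-edition
pp. 38–39) and **Lemma 5.2** (p. 40): for a constant-sum family of CM types the WEIL CLASSES
`H^{2m}(⊕_j A_{Φ_j})_{Δ×{s}}` are (absolute) Hodge classes, products of divisor classes when the family is a union of
conjugate pairs; the tree's dictionary `Deligne1982/WeilClassesCMFamilyDivisorCriterion`: the Weil line of `s` lies in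
`Dᵐ ⊗ ℂ` iff `d(Ψ) = d(Ψ̄)` for every type `Ψ` (`weightClassesAlg_weilWeight_le_divisorClassesSpan_iff`), and otherwise
the product carries EXCEPTIONAL rational `(m,m)` classes (`exists_exceptional_of_typeCount_ne`, White's count
`finrank_le_finrank_hodgeClassSpan_sub_finrank_divisorClassesSpan`).

THE THEOREMS (`K = ℚ(ζ₇)`; its eight CM types: six primitive `Pᵢ`, realised by SIMPLE CM threefolds, and
`Q = {1,2,4}`, `Q̄ = {3,5,6}` induced from `ℚ(√-7)`, realised by `E³` with the two conjugate `𝓞_K`-structures — part 1),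
for every `m`, every constant-sum family `Ψ` and every family `(A_j, ι_j, θ_j)_{j<2m}` of realisations:

* **`iSup_weilLine_le_divisorClassesSpan_iff`** — ALL the `ℚ(ζ₇)`-Weil lines lie in `Dᵐ(⊕ A_j) ⊗ ℂ` iff the factors of
  type `Q` and of type `Q̄` are EQUALLY MANY (each single Weil line likewise, `weilLine_le_divisorClassesSpan_iff`; part
  2's `iSup_weilLine_le_divisorClassesSpan_of_isSimple` is the instance `0 = 0`);
* `exists_exceptional_of_resCount_ne` / `six_le_finrank_sub_of_resCount_ne` — otherwise `⊕ A_j` carries exceptional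
  rational `(m,m)` classes, at least `6 = [ℚ(ζ₇):ℚ]` dimensions of them;
* `resCount_add_resCount_eq_ncard_not_isSimple` — `#Q + #Q̄` is the number of NON-SIMPLE factors (Shimura §8.2
  Prop. 26 both ways); hence an ODD number of non-simple factors forces exceptional Weil classes
  (**`exists_exceptional_of_odd`**: e.g. exactly one factor `≅ E³`, the Moonen–Zarhin shape `E × B`), while a family
  whose non-simple factors all carry the same `𝓞_K`-structure has divisorial Weil lines iff it has none at all
  (`iSup_weilLine_le_divisorClassesSpan_iff_forall_isSimple`);
* §4 the census family `Φ7 = (Q, P₄, P₂, P₅)` of `Census/DeligneWeilFamilyZeta7` (seat lit-deligne-3) has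
  `#Q = 1`, `#Q̄ = 0` (`resCount_Φ7`): its exceptional classes are the instance `1 ≠ 0` (`not_typeCount_symmetric_Φ7`).

So over `ℚ(ζ₇)` exceptionality of Deligne's Weil LINES is decided by ONE integer, `#Q − #Q̄`: e.g. the `8`-member
family `Φ7 ⊔ Φ̄7` (one factor `E³` with each `𝓞_K`-structure) has only divisorial Weil lines although it contains
non-simple factors (the Weil classes of its sub-product `Φ7`, of codimension `2` there, stay exceptional — not treated
here).

## References

* [Deligne1982HodgeCycles] P. Deligne, *Hodge cycles on abelian varieties*, LNM 900 (1982), I §5 (c), Lemma 5.2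
  (re-edition pp. 38–40).
* [Shimura1998] G. Shimura, *Abelian Varieties with Complex Multiplication and Modular Functions* (1998), §8.2
  Prop. 26, §6.2 Thm. 3.
* [Gordon1999HodgeAVSurvey] B. B. Gordon, *A survey of the Hodge conjecture for abelian varieties*, 9.2.2, §9.3.
* [MoonenZarhin1999] B. Moonen, Yu. Zarhin, *Hodge classes on abelian varieties of low dimension*, Math. Ann. 315
  (1999) 711–733, §0 (exceptional classes on `E × B`).
* [Washington1997] L. C. Washington, *Introduction to Cyclotomic Fields*, Thm. 2.5.
-/

noncomputable section

open CategoryTheory CategoryTheory.Limits NumberField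

namespace Summit.HodgeConjecture.CorCM.Zeta7WeilFamily

open Literature.NumberTheory.ComplexMultiplication
open Literature.AlgebraicGeometry.Motives (AbelianVariety CMType)
open Literature.AlgebraicGeometry.HodgeTheory
open Literature.AlgebraicGeometry.ComplexMultiplication (IsCMTypeRealisation)
open Literature.AlgebraicGeometry.VanGeemen1994 (hodgeClassSpan)
open Literature.AlgebraicGeometry.Pohlmann1968
open Literature.AlgebraicGeometry.Pohlmann1968.Cyclotomic
open Literature.AlgebraicGeometry.Deligne1982
open Literature.Barriers.HodgeConjecture (divisorClassesSpan)
open Summit.HodgeConjecture.CorCM.Census.DeligneWeilFamilyZeta7 (S7 Φ7)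

/-! ### §3 Geometry: Weil classes on products of CM threefolds with CM by `ℚ(ζ₇)` -/

section Geometry

variable {L : Type} [Field L] [NumberField L] [IsCyclotomicExtension {7} ℚ L] {m : ℕ}
variable {Ψ : Fin (2 * m) → CMType L} {A : Fin (2 * m) → AbelianVariety ℂ} {ι : ∀ j, 𝓞 L →+* End (A j)}
  {θ : ∀ j, L →+* Module.End ℂ (complexBetti (A j).X 1)}

/-- **The Weil line of `s` is divisorial iff `#Q = #Q̄`**: for a constant-sum family `Ψ` over `ℚ(ζ₇)` and ANY family
of realisations `(A_j, ι_j, θ_j)`, the `ℚ(ζ₇)`-Weil line `H^{2m}(⊕ A_j)_{Δ×{s}}` lies in `Dᵐ(⊕ A_j) ⊗ ℂ` iff the factors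
realising `Q = {1,2,4}` and those realising `Q̄ = {3,5,6}` are equally many (the criterion does not depend on `s`).
[cite: Deligne1982HodgeCycles, I §5 (c) and Lemma 5.2 (pp. 38–40)] [cite: Gordon1999HodgeAVSurvey, 9.2.2 and §9.3] -/
theorem weilLine_le_divisorClassesSpan_iff (hA : ∀ j, IsCMTypeRealisation (Ψ j) (A j) (ι j) (θ j))
    (hsum : ∀ t : L →+* ℂ, {j : Fin (2 * m) | t ∈ (Ψ j).1}.ncard = m) (s : L →+* ℂ) :
    weightClassesAlg (K := fun _ : Fin (2 * m) => L) A ι (2 * m) (weilWeight m s) ≤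
        divisorClassesSpan (⨁ A).X (⨁ A).dim m ↔ resCount Ψ {1, 2, 4} = resCount Ψ {3, 5, 6} :=
  (weightClassesAlg_weilWeight_le_divisorClassesSpan_iff hA s).trans (typeCount_symmetric_iff Ψ hsum)

/-- **MAIN THEOREM.  Over `ℚ(ζ₇)`, ALL of Deligne's Weil lines on `⊕_j A_j` are divisor classes iff the two
`ℚ(√-7)`-induced types occur equally often among the factors** (`#{j | resSet Ψ_j = {1,2,4}} = #{j | resSet Ψ_j =
{3,5,6}}`: equally many copies of `E³` with each of the two conjugate `𝓞_{ℚ(ζ₇)}`-structures), for every `m`, every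
constant-sum family `Ψ : Fin (2m) → CMType ℚ(ζ₇)` and every family of realisations.  Part 2
(`iSup_weilLine_le_divisorClassesSpan_of_isSimple`) is the case `0 = 0`.
[cite: Deligne1982HodgeCycles, I §5 (c) and Lemma 5.2 (pp. 38–40)] [cite: Shimura1998, §8.2 Prop. 26]
[cite: Gordon1999HodgeAVSurvey, 9.2.2 and §9.3] -/
theorem iSup_weilLine_le_divisorClassesSpan_iff (hA : ∀ j, IsCMTypeRealisation (Ψ j) (A j) (ι j) (θ j))
    (hsum : ∀ t : L →+* ℂ, {j : Fin (2 * m) | t ∈ (Ψ j).1}.ncard = m) :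
    ⨆ s : L →+* ℂ, weightClassesAlg (K := fun _ : Fin (2 * m) => L) A ι (2 * m) (weilWeight m s) ≤
        divisorClassesSpan (⨁ A).X (⨁ A).dim m ↔ resCount Ψ {1, 2, 4} = resCount Ψ {3, 5, 6} := by
  constructor
  · intro h
    obtain ⟨s⟩ := (inferInstance : Nonempty (L →+* ℂ))
    exact (weilLine_le_divisorClassesSpan_iff hA hsum s).1 ((le_iSup _ s).trans h)
  · intro he
    exact iSup_le fun s => (weilLine_le_divisorClassesSpan_iff hA hsum s).2 he

/-- **Exceptional Weil classes iff `#Q ≠ #Q̄` (one direction)**: if the factors of type `{1,2,4}` and of type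
`{3,5,6}` are NOT equally many, `⊕_j A_j` carries a rational `(m,m)` class outside `Dᵐ ⊗ ℂ` (every Weil line is then
exceptional). [cite: Deligne1982HodgeCycles, I §5 (c) (pp. 38–39)] [cite: Gordon1999HodgeAVSurvey, 9.2.2 and §9.3]
[cite: MoonenZarhin1999, §0] -/
theorem exists_exceptional_of_resCount_ne (hA : ∀ j, IsCMTypeRealisation (Ψ j) (A j) (ι j) (θ j))
    (hsum : ∀ t : L →+* ℂ, {j : Fin (2 * m) | t ∈ (Ψ j).1}.ncard = m)
    (hne : resCount Ψ {1, 2, 4} ≠ resCount Ψ {3, 5, 6}) :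
    ∃ c : complexBetti (⨁ A).X (2 * m), IsRationalClass c ∧
      IsOfHodgeType (⨁ A).dim (⨁ A).X (2 * m) m m c ∧ c ∉ divisorClassesSpan (⨁ A).X (⨁ A).dim m := by
  refine exists_exceptional_of_typeCount_ne hA hsum ?_
  by_contra h
  push Not at h
  exact hne ((typeCount_symmetric_iff Ψ hsum).1 h)

/-- **At least `6 = [ℚ(ζ₇):ℚ]` independent exceptional classes**: if `#Q ≠ #Q̄` (and `m ≠ 0`), then
`6 ≤ dim_ℂ (Bᵐ(⊕ A_j) ⊗ ℂ) − dim_ℂ (Dᵐ(⊕ A_j) ⊗ ℂ)` — all six Weil lines are exceptional at once (White's count).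
[cite: Gordon1999HodgeAVSurvey, 9.2.2] [cite: Deligne1982HodgeCycles, I §5 (c) (pp. 38–39)] -/
theorem six_le_finrank_sub_of_resCount_ne (hA : ∀ j, IsCMTypeRealisation (Ψ j) (A j) (ι j) (θ j)) (hm : 0 < m)
    (hsum : ∀ t : L →+* ℂ, {j : Fin (2 * m) | t ∈ (Ψ j).1}.ncard = m)
    (hne : resCount Ψ {1, 2, 4} ≠ resCount Ψ {3, 5, 6}) :
    6 ≤ Module.finrank ℂ ↥(hodgeClassSpan (⨁ A).dim (⨁ A).X m) -
        Module.finrank ℂ ↥(divisorClassesSpan (⨁ A).X (⨁ A).dim m) := by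
  have h6 : Module.finrank ℚ L = 6 := by rw [finrank_eq_totient 7 L]; decide
  rw [← h6]
  refine finrank_le_finrank_hodgeClassSpan_sub_finrank_divisorClassesSpan hA hm hsum ?_
  by_contra h
  push Not at h
  exact hne ((typeCount_symmetric_iff Ψ hsum).1 h)

/-- No primitive residue set is `{1,2,4}` or `{3,5,6}`. [cite: Shimura1998, §8.2 Prop. 26] -/
theorem prim7_ne_squares : ∀ i : Fin 6, prim7 i ≠ {1, 2, 4} ∧ prim7 i ≠ {3, 5, 6} := by decide

/-- **A factor is non-simple iff its type is `ℚ(√-7)`-induced**: `A_j` is not simple iff `resSet Ψ_j ∈ {Q, Q̄}`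
(Shimura §8.2 Prop. 26 both ways, via part 1). [cite: Shimura1998, §8.2 Prop. 26 and §6.2 Thm. 3] -/
theorem not_isSimple_iff_resSet (hA : ∀ j, IsCMTypeRealisation (Ψ j) (A j) (ι j) (θ j)) (j : Fin (2 * m)) :
    ¬ (A j).IsSimple ↔ (resSet L (Ψ j) = {1, 2, 4} ∨ resSet L (Ψ j) = {3, 5, 6}) := by
  constructor
  · exact resSet_eq_squares_or_of_not_isSimple L (Ψ j) (hA j)
  · intro h hS
    obtain ⟨i, hi⟩ := exists_prim7_eq_resSet_of_isSimple L (Ψ j) (hA j) hS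
    rcases h with h | h
    · exact (prim7_ne_squares i).1 (hi.trans h)
    · exact (prim7_ne_squares i).2 (hi.trans h)

/-- **`#Q + #Q̄` is the number of NON-SIMPLE factors** (each `≅ E³` up to isogeny, `E` with CM by `ℚ(√-7)`).
[cite: Shimura1998, §8.2 Prop. 26 and §6.2 Thm. 3] [cite: MoonenZarhin1999, §0] -/
theorem resCount_add_resCount_eq_ncard_not_isSimple (hA : ∀ j, IsCMTypeRealisation (Ψ j) (A j) (ι j) (θ j)) :
    resCount Ψ {1, 2, 4} + resCount Ψ {3, 5, 6} = {j : Fin (2 * m) | ¬ (A j).IsSimple}.ncard := by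
  have hQ : ({1, 2, 4} : Finset (ZMod 7)) ≠ {3, 5, 6} := by decide
  unfold resCount
  rw [← Set.ncard_union_eq (Set.disjoint_left.2 fun j h1 h2 => hQ (h1.symm.trans h2))]
  congr 1
  ext j
  simp only [Set.mem_union, Set.mem_setOf_eq]
  exact (not_isSimple_iff_resSet hA j).symm

/-- **An ODD number of non-simple factors forces exceptional Weil classes** (then `#Q ≠ #Q̄`): e.g. every constant-sum
family over `ℚ(ζ₇)` with exactly one factor `≅ E³` — the census shape `E³ × A₁ × A₂ × A₃` of
`Census/DeligneWeilFamilyZeta7`, the Moonen–Zarhin shape `E × B`. [cite: MoonenZarhin1999, §0]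
[cite: Deligne1982HodgeCycles, I §5 (c) (pp. 38–39)] [cite: Gordon1999HodgeAVSurvey, 9.2.2 and §9.3] -/
theorem exists_exceptional_of_odd (hA : ∀ j, IsCMTypeRealisation (Ψ j) (A j) (ι j) (θ j))
    (hsum : ∀ t : L →+* ℂ, {j : Fin (2 * m) | t ∈ (Ψ j).1}.ncard = m)
    (hodd : Odd {j : Fin (2 * m) | ¬ (A j).IsSimple}.ncard) :
    ∃ c : complexBetti (⨁ A).X (2 * m), IsRationalClass c ∧
      IsOfHodgeType (⨁ A).dim (⨁ A).X (2 * m) m m c ∧ c ∉ divisorClassesSpan (⨁ A).X (⨁ A).dim m := by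
  refine exists_exceptional_of_resCount_ne hA hsum fun he => ?_
  rw [← resCount_add_resCount_eq_ncard_not_isSimple hA, he] at hodd
  exact (Nat.not_odd_iff_even.2 (Even.add_self _)) hodd

/-- **One `𝓞_K`-structure only: divisorial iff all factors simple.**  If no factor realises `Q̄ = {3,5,6}` (all the
non-simple factors carry the SAME `𝓞_{ℚ(ζ₇)}`-structure on `E³`), then all Weil lines are divisorial iff every factor
is simple — part 2's theorem and its converse in that case. [cite: Shimura1998, §8.2 Prop. 26 and §6.2 Thm. 3]
[cite: Deligne1982HodgeCycles, I §5 (c) and Lemma 5.2 (pp. 38–40)] -/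
theorem iSup_weilLine_le_divisorClassesSpan_iff_forall_isSimple
    (hA : ∀ j, IsCMTypeRealisation (Ψ j) (A j) (ι j) (θ j))
    (hsum : ∀ t : L →+* ℂ, {j : Fin (2 * m) | t ∈ (Ψ j).1}.ncard = m) (h7 : ∀ j, resSet L (Ψ j) ≠ {3, 5, 6}) :
    ⨆ s : L →+* ℂ, weightClassesAlg (K := fun _ : Fin (2 * m) => L) A ι (2 * m) (weilWeight m s) ≤
        divisorClassesSpan (⨁ A).X (⨁ A).dim m ↔ ∀ j, (A j).IsSimple := by
  rw [iSup_weilLine_le_divisorClassesSpan_iff hA hsum, resCount_eq_zero_of_forall_ne Ψ h7]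
  constructor
  · intro h0 j
    by_contra hj
    rcases (not_isSimple_iff_resSet hA j).1 hj with h | h
    · exact (Nat.pos_iff_ne_zero.1 (resCount_pos_of_eq Ψ h)) h0
    · exact h7 j h
  · intro hS
    refine resCount_eq_zero_of_forall_ne Ψ fun j h => ?_
    exact (not_isSimple_iff_resSet hA j).2 (Or.inl h) (hS j)

end Geometry

/-! ### §4 The census family `Φ7 = (Q, P₄, P₂, P₅)`: `#Q = 1`, `#Q̄ = 0` -/

section Census

variable (L : Type) [Field L] [NumberField L] [IsCyclotomicExtension {7} ℚ L]

/-- The residue set of the type `Φ_S` cut out by a CM residue set `S ⊆ (ℤ/7)ˣ` is `S`. [cite: Washington1997, Thm. 2.5] -/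
theorem resSet_cmTypeOfResidues {S : Finset (ZMod 7)} (hS : ∀ c : ZMod 7, c.val.Coprime 7 → (c ∈ S ↔ -c ∉ S))
    (hSu : S ⊆ units7) : resSet L (cmTypeOfResidues (L := L) S hS) = S := by
  ext c
  constructor
  · intro hc
    obtain ⟨σ, rfl⟩ := exists_expOf_eq 7 L c ((coprime_seven_iff_mem_units7 c).2 (resSet_subset L _ hc))
    exact (mem_cmTypeOfResidues_iff σ).1 ((mem_resSet_iff L _ σ).1 hc)
  · intro hc
    obtain ⟨σ, rfl⟩ := exists_expOf_eq 7 L c ((coprime_seven_iff_mem_units7 c).2 (hSu hc))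
    exact (mem_resSet_iff L _ σ).2 ((mem_cmTypeOfResidues_iff σ).2 hc)

/-- The residue sets of the census family are its defining sets `S7 j`. [cite: Washington1997, Thm. 2.5] -/
theorem resSet_Φ7 (j : Fin (2 * 2)) : resSet L (Φ7 L j) = S7 j :=
  resSet_cmTypeOfResidues L _ (by revert j; decide)

/-- **The census family has `#Q = 1` and `#Q̄ = 0`** (`Φ7 = (Q, P₄, P₂, P₅)` with `Q = S7 0 = {1,2,4}`): its exceptional
Weil classes (`Census.DeligneWeilFamilyZeta7.exists_exceptional_Φ7`) are the instance `1 ≠ 0` of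
`exists_exceptional_of_resCount_ne`. [cite: Deligne1982HodgeCycles, I §5 (c) (pp. 38–39)] -/
theorem resCount_Φ7 : resCount (Φ7 L) {1, 2, 4} = 1 ∧ resCount (Φ7 L) {3, 5, 6} = 0 := by
  unfold resCount
  simp only [resSet_Φ7]
  rw [ncard_setOf_fin_eq_card_filter, ncard_setOf_fin_eq_card_filter]
  decide

/-- The census family's multiplicities are NOT conjugation-symmetric — recovered from the criterion
(`typeCount_symmetric_iff`: `1 ≠ 0`); cf. `Census.DeligneWeilFamilyZeta7.typeCount_ne_Φ7`.
[cite: Deligne1982HodgeCycles, I §5 (c) (pp. 38–39)] -/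
theorem not_typeCount_symmetric_Φ7 : ¬ ∀ S, typeCount (Φ7 L) S = typeCount (Φ7 L) Sᶜ := by
  rw [typeCount_symmetric_iff (Φ7 L)
    (Summit.HodgeConjecture.CorCM.Census.DeligneWeilFamilyZeta7.ncard_mem_Φ7 L), (resCount_Φ7 L).1, (resCount_Φ7 L).2]
  exact one_ne_zero

end Census

end Summit.HodgeConjecture.CorCM.Zeta7WeilFamily

end
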